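import Summits.BirchSwinnertonDyer.BirchSwinnertonDyer.Theorems.ClassRecordThreeCornerAtThreeControlOfFacts
import Summits.BirchSwinnertonDyer.BirchSwinnertonDyer.Theorems.ErratumRoadFiveControlFromJSWMult
import HarnessLib

/-!
# Route `ErratumRoadFive` (rung K2), support item 19626 `JSWAnticyclotomicControlMult` — the binder `h331` of
# `Theses.ErratumRoadFive.closes` is REDUNDANT: the control identity at every datum the route uses is a theorem of the
# tree modulo four cited facts that `closes` already binds (cell `bsd-stepL`, seat `bsd-stepL-imc-p1` g16;
# `--supports stmt-BirchSwinnertonDyer-19626`)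

HONEST FRAMING: theorems only (no definition, no named fact, no `sorry`); CONDITIONAL on the cited Literature facts
`rank_eq_analyticRank_of_analyticRank_le_one` (GZK), `exists_isNewformOf` (modularity),
`poitouTate_selmerStructure_duality` and `poitouTate_sha_tateDual` (Poitou–Tate), taken BY NAME as hypotheses —
conjuncts 2, 4, 13, 14 of the route's binder `PublishedInputsIMCReduction`. Nothing is asserted about any curve; item
19626 (the Jetchev–Skinner–Wan fact VERBATIM: `Ш(E/K)[p^∞]`-finiteness only, `rank E(K) = 1` as an input, any `ι`)
is NOT closed by this file; nothing about BSD is proved; no census word, tier or label moves (T7).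

## What this file proves

The deciding theorem `Theses.ErratumRoadFive.closes` binds `h331 : JSWAnticyclotomicControlMult`
(`JetchevSkinnerWan2017.thm331_anticyclotomicControl_mult`, JSW17 Thm. 3.3.1 at a multiplicative `p`, PUB) and
uses it in exactly two places: (a) `p2ControlOnTreeAt_of_thm331Mult` inside
`KernelFromPrintB.openInputIMCBody_of_print_of_coreB_of_rest3_of_notRam` (the control identity at the route-p2 data
of a (ram) ∧ erratum pair), and (b) `P2.RoadFF.isTorsion_XAc_empty_of_thm331_of_isErratumField` inside
`P2.RoadFF.sigmaDataAtErratumDataB_of_sigmaLocal_of_prop323_of_thm331` (torsion of `X^∅_ac` at an erratum field).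
Both data are MULTIPLICATIVE RANK-ONE data in the sense of the tree's kernel control theorem
`X11b.controlOnTreeAt_of_mult_of_rankOne_odd` (`Theorems/ClassRecordThreeCornerAtThreeControlOfFacts.lean` §1:
`W/ℚ` of analytic rank one, `p` odd multiplicative, `K` imaginary quadratic with `p` split and `L(E^{(d_K)},1) ≠ 0`,
`P` of infinite order, anticyclotomic `κ`, generator `γ`, degree-one `𝔭`; ANY image, ANY `p`-torsion — over
`CtlLoc.controlOnTreeAt_of_split_anyTorsion` (bsd-eis) and `X2.controlOnTreeAt_of_not_split_of_rankOne`
(bsd-schneider); Brink Thm. 2, Milne I Thm. 2.8 and `cd_p ≤ 2` discharged in-kernel), which is conditional on the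
four cited facts above ONLY. Hence, with `h331` replaced by those four facts:

* §1 `p2ControlOnTreeAt_of_facts` — `X11b.P2ControlOnTreeAt W p` at EVERY `(W, p)` (drop-in for
  `p2ControlOnTreeAt_of_thm331Mult`; Kolyvagin over `K` is not needed either); `p2ControlOnTreeAt_forall_of_facts`;
  `p2ControlOnTree_odd_of_facts` (the odd-`p` frames of `Three/OpenInputTight`, drop-in for
  `p2ControlOnTree_odd_of_thm331Mult`).
* §2 `r1ControlOnTreeAt_of_facts` — route R1's currency `X11b.R1ControlOnTreeAt W p` (erratum fields), drop-in for
  `r1ControlOnTreeAt_of_thm331Mult`.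
* §3 `P2.RoadFF.isTorsion_XAc_empty_of_facts_of_isErratumField` — `X^∅_ac(E/K_∞)_v` is `Λ`-torsion at an erratum
  datum, ANY slot `v ∋ p` (drop-in for `P2.RoadFF.isTorsion_XAc_empty_of_thm331_of_isErratumField`, same binders
  with `h331 ↦ hPT, hPT2`); and `controlOnTreeAt_of_facts_of_isErratumField` (the full identity there).
* §4 `openInputOnTreeAt_of_missingLowerBoundAt_of_ram_of_facts` — imc-p1's one-sided tightness on the (ram) atom
  with its control hypothesis discharged by §1 (drop-in for `openInputOnTreeAt_of_missingLowerBoundAt_of_ram_of_thm331Mult`).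

Consequence (bookkeeping for the planner, nothing booked): `closes` can be re-glued WITHOUT the binder `h331`
(support item 19626), every other binder unchanged — the K2 cone loses the published input JSW17 Thm. 3.3.1 by name
and gains no hypothesis. The JSW fact itself stays citable (and item 19626 open) for consumers outside `closes`.

References: [JetchevSkinnerWan2017] Thm. 3.3.1, Prop. 3.2.1, Prop. 3.3.2, Lemma 3.3.3, Prop. 3.3.4
(arXiv:1512.06894 pp. 10–13), §3.5 (3.5.c) (p. 15); [Castella2018] Thm. 2.3 (arXiv:1704.06608 p. 5);
[MilneADT2006] I Thm. 4.10, Thm. 2.8; [Brink2007] Thm. 2, Cor. 1; [GrossLMS1991] Thm. 1.3.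
-/

noncomputable section

set_option autoImplicit false
set_option linter.dupNamespace false

open scoped Classical

open WeierstrassCurve NumberField IsDedekindDomain Field Literature.NumberTheory.EllipticCurves
  Literature.NumberTheory.EllipticCurves.ModularForms
  Literature.NumberTheory.EllipticCurves.GreenbergSelmer
  Literature.NumberTheory.GaloisRepresentations Literature.NumberTheory.GaloisCohomology
  Literature.NumberTheory.EllipticCurves.Rank1Residual
  Literature.NumberTheory.EllipticCurves.Rank1Residual.Typed
  Summit.BirchSwinnertonDyer.Rank1Residual Summit.BirchSwinnertonDyer.Rank1Residual.X11b
  Summit.BirchSwinnertonDyer.Rank1Residual.X11b.AcSelmer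

namespace Summit.BirchSwinnertonDyer.BirchSwinnertonDyer.Theorems

/-! ### §1 Route p2's control identity at EVERY pair, from the four cited facts -/

section P2

variable (W : WeierstrassCurve ℚ) [W.IsElliptic] [W.IsGloballyMinimal] (p : ℕ) [Fact p.Prime]

/-- **`X11b.P2ControlOnTreeAt W p` at EVERY `(W, p)` from GZK, modularity and the two Poitou–Tate facts — NO
Jetchev–Skinner–Wan fact, NO Kolyvagin over `K`.** At a p2 datum (`ClassX11b W p`, so `ord_{s=1} L(E,s) = 1` and `p`
multiplicative; `p ≥ 5`; `K` imaginary quadratic satisfying the Heegner hypothesis for `N_E`, so `p ∣ N_E` splits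
in `K`; `L(E^{(d_K)},1) ≠ 0`; `P` of infinite order; anticyclotomic `κ`, generator `γ`, degree-one `𝔭 ∋ p`, THE
embedding `embAt`) the tree's kernel control theorem `X11b.controlOnTreeAt_of_mult_of_rankOne_odd` applies verbatim
(the binders `Surj`, `d_K` odd, `p ∤ d_K`, `p ∤ #𝓞_Kˣ`, the parametrisation and `p ∤ c` are not used: control is
image-free). Drop-in replacement for `p2ControlOnTreeAt_of_thm331Mult`. CONDITIONAL on the four cited facts.
[cite: JetchevSkinnerWan2017, Thm. 3.3.1 with §3.5 (3.5.c) (arXiv:1512.06894 pp. 11, 15)]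
[cite: Castella2018, Thm. 2.3 (arXiv:1704.06608 p. 5)] [cite: MilneADT2006, Ch. I, Thm. 4.10 and Thm. 2.8] -/
theorem p2ControlOnTreeAt_of_facts
    (hGZK : rank_eq_analyticRank_of_analyticRank_le_one) (hnf : exists_isNewformOf)
    (hPT : ∀ (K : Type) [Field K] [NumberField K], poitouTate_selmerStructure_duality K)
    (hPT2 : ∀ (K : Type) [Field K] [NumberField K], poitouTate_sha_tateDual K) :
    P2ControlOnTreeAt W p := by
  intro N _ K _ _ Dt H ι P hX hp5 _ hN hK _ _ _ hHN hLt _ _ hPinf κ hκ γ _ 𝔭 h𝔭 he hf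
  obtain ⟨hr, hp2, hmult, -⟩ := hX
  have hsplit : SplitsIn K p := hHN p Fact.out (hN ▸ dvd_conductorNorm_of_mult hmult)
  exact controlOnTreeAt_of_mult_of_rankOne_odd W p hGZK hnf hPT hPT2 hp2 hmult hr hK hsplit hLt P hPinf
    κ hκ γ 𝔭 h𝔭 he hf

/-- **`X11b.P2ControlOnTreeAt` at every pair, universally quantified** (the form consumed by class-level glue), from
the four cited facts. [cite: JetchevSkinnerWan2017, Thm. 3.3.1 with §3.5 (3.5.c) (arXiv:1512.06894 pp. 11, 15)] -/
theorem p2ControlOnTreeAt_forall_of_facts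
    (hGZK : rank_eq_analyticRank_of_analyticRank_le_one) (hnf : exists_isNewformOf)
    (hPT : ∀ (K : Type) [Field K] [NumberField K], poitouTate_selmerStructure_duality K)
    (hPT2 : ∀ (K : Type) [Field K] [NumberField K], poitouTate_sha_tateDual K) :
    ∀ (W : WeierstrassCurve ℚ) [W.IsElliptic] [W.IsGloballyMinimal] (p : ℕ) [Fact p.Prime],
      P2ControlOnTreeAt W p :=
  fun W _ _ p _ ↦ p2ControlOnTreeAt_of_facts W p hGZK hnf hPT hPT2

/-- **The odd-`p` control frames of `Three/OpenInputTight` (`hC`: `ControlOnTreeAt` at every p2-type datum of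
the pair, no `p ≥ 5`, so `p = 3` included) at EVERY X11b pair, from the four cited facts** — drop-in replacement
for `p2ControlOnTree_odd_of_thm331Mult` (`ClassX11b W p` gives `p ≠ 2`, `ord_{s=1} L(E,s) = 1` and `Mult W p`; the
Heegner hypothesis makes `p ∣ N_E` split). CONDITIONAL on the four cited facts; nothing booked.
[cite: JetchevSkinnerWan2017, Thm. 3.3.1 with §3.5 (3.5.c) (arXiv:1512.06894 pp. 11, 15; §2.1 "p ≥ 3")]
[cite: Castella2018, Thm. 2.3 (arXiv:1704.06608 p. 5)] -/
theorem p2ControlOnTree_odd_of_facts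
    (hGZK : rank_eq_analyticRank_of_analyticRank_le_one) (hnf : exists_isNewformOf)
    (hPT : ∀ (K : Type) [Field K] [NumberField K], poitouTate_selmerStructure_duality K)
    (hPT2 : ∀ (K : Type) [Field K] [NumberField K], poitouTate_sha_tateDual K) :
    ∀ (N : ℕ) [NeZero N] (K : Type) [Field K] [NumberField K]
      (Dt : ModularParametrizationData W N) (H : HeegnerDatum N (NumberField.discr K)) (ι : K →+* ℂ)
      (P : (W.baseChange K).toAffine.Point),
      ClassX11b W p → Surj W p → W.conductorNorm ℤ = N → IsImaginaryQuadratic K →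
      Odd (NumberField.discr K) → ¬ (p : ℤ) ∣ NumberField.discr K → ¬ p ∣ Units.torsionOrder K →
      SatisfiesHeegnerHypothesis N K →
      (W.quadraticTwist (NumberField.discr K : ℚ)).entireLFunction 1 ≠ 0 →
      WeierstrassCurve.Affine.Point.map ι.toRatAlgHom P = heegnerPointComplex Dt H →
      ¬ (p : ℤ) ∣ Dt.c → ¬ IsOfFinAddOrder P →
      ∀ (κ : ZpExtension K p), κ.IsAnticyclotomic →
        ∀ (γ : Field.absoluteGaloisGroup K) [Fact (κ.IsTopGenerator γ)]
          (𝔭 : HeightOneSpectrum (𝓞 K)) (h𝔭 : ((p : ℕ) : 𝓞 K) ∈ 𝔭.asIdeal)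
          (he : 𝔭.asIdeal.ramificationIdx (𝓞 ℚ) = 1) (hf : 𝔭.asIdeal.inertiaDeg (𝓞 ℚ) = 1),
          ControlOnTreeAt p κ 𝔭 γ (embAt K p 𝔭 h𝔭 he hf) P := by
  intro N _ K _ _ Dt H ι P hX _ hN hK _ _ _ hHN hLt _ _ hPinf κ hκ γ _ 𝔭 h𝔭 he hf
  obtain ⟨hr, hp2, hmult, -⟩ := hX
  have hsplit : SplitsIn K p := hHN p Fact.out (hN ▸ dvd_conductorNorm_of_mult hmult)
  exact controlOnTreeAt_of_mult_of_rankOne_odd W p hGZK hnf hPT hPT2 hp2 hmult hr hK hsplit hLt P hPinf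
    κ hκ γ 𝔭 h𝔭 he hf

end P2

/-! ### §2 Route R1's currency: `R1ControlOnTreeAt W p` from the four cited facts -/

section RouteR1

variable (W : WeierstrassCurve ℚ) [W.IsElliptic] [W.IsGloballyMinimal] (p : ℕ) [Fact p.Prime]

/-- **`X11b.R1ControlOnTreeAt W p` from GZK, modularity and the two Poitou–Tate facts — NO Jetchev–Skinner–Wan
fact.** At every datum of route R1's input (A′-hypotheses `5 ≤ p`, `mult(p)`; `r_an = 1`; a multiplicative `q ≠ p`;
an erratum field `K` for `q` — imaginary quadratic, `p ∣ N_E` splits in `K` (`IsErratumField.splitsIn_of_mult`),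
`L(E^{(d_K)},1) ≠ 0` (last conjunct); `P` of infinite order; anticyclotomic `κ`, generator `γ`, degree-one `𝔭 ∋ p`)
the kernel control theorem `X11b.controlOnTreeAt_of_mult_of_rankOne_odd` applies (the (ram) witness, irreducibility,
(iv), the parametrisation and [Cas20 §2.5]'s standing hypotheses are not used). Drop-in replacement for
`r1ControlOnTreeAt_of_thm331Mult`. CONDITIONAL on the four cited facts; nothing booked.
[cite: JetchevSkinnerWan2017, Thm. 3.3.1 with §3.5 (3.5.c) (arXiv:1512.06894 pp. 11, 15)]
[cite: Castella2018, Thm. 2.3 and §5 (arXiv:1704.06608 pp. 5, 12)] -/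
theorem r1ControlOnTreeAt_of_facts
    (hGZK : rank_eq_analyticRank_of_analyticRank_le_one) (hnf : exists_isNewformOf)
    (hPT : ∀ (K : Type) [Field K] [NumberField K], poitouTate_selmerStructure_duality K)
    (hPT2 : ∀ (K : Type) [Field K] [NumberField K], poitouTate_sha_tateDual K) :
    R1ControlOnTreeAt W p := by
  intro _ q _ K _ _ Dt H ι P hE hr hqp _ _ _ hK _ _ _ hinf κ hκ γ _ 𝔭 h𝔭 he hf
  have hp2 : p ≠ 2 := by
    have h5 : 5 ≤ p := hE.1
    omega
  have hsp : SplitsIn K p := hK.splitsIn_of_mult hE.2.1 (Ne.symm hqp)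
  exact controlOnTreeAt_of_mult_of_rankOne_odd W p hGZK hnf hPT hPT2 hp2 hE.2.1 hr hK.1 hsp hK.2.2.2.2 P
    hinf κ hκ γ 𝔭 h𝔭 he hf

end RouteR1

end Summit.BirchSwinnertonDyer.BirchSwinnertonDyer.Theorems

/-! ### §3 Road FF: the control identity and the torsion of `X^∅_ac` at an erratum field, any slot, from the facts -/

namespace Summit.BirchSwinnertonDyer.Rank1Residual.X11b

section Torsion

variable (W : WeierstrassCurve ℚ) [W.IsElliptic] [W.IsGloballyMinimal] (p : ℕ) [Fact p.Prime]
  {K : Type} [Field K] [NumberField K]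

/-- **The control identity at an erratum field, ANY degree-one slot `v ∋ p`, from the four cited facts.**
Hypotheses as in `P2.RoadFF.isTorsion_XAc_empty_of_thm331_of_isErratumField` with `h331` replaced by `hPT`,
`hPT2`: `p` odd and multiplicative, `ord_{s=1} L(E,s) = 1`, a prime `q ≠ p`, an erratum field `K` for `q`
(imaginary quadratic; `p ∣ N_E`, `p ≠ q` splits in `K`; `L(E^{(d_K)},1) ≠ 0`), `P ∈ E(K)` of infinite order, `κ`
anticyclotomic with generator `γ`, `v ∋ p` (degree one since `p` splits; THE embedding `embAt K p v`).
[cite: JetchevSkinnerWan2017, Thm. 3.3.1 with §3.5 (3.5.c) (arXiv:1512.06894 pp. 11, 15)]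
[cite: Castella2018, Thm. 2.3 (arXiv:1704.06608 p. 5)] -/
theorem P2.RoadFF.controlOnTreeAt_of_facts_of_isErratumField
    (hGZK : rank_eq_analyticRank_of_analyticRank_le_one) (hnf : exists_isNewformOf)
    (hPT : ∀ (K : Type) [Field K] [NumberField K], poitouTate_selmerStructure_duality K)
    (hPT2 : ∀ (K : Type) [Field K] [NumberField K], poitouTate_sha_tateDual K)
    (hp2 : p ≠ 2) (hmult : Mult W p) (hr : W.analyticRank = 1) {q : ℕ} [Fact q.Prime] (hqp : q ≠ p)
    (hK : IsErratumField W K q) (P : (W.baseChange K).toAffine.Point) (hP : ¬ IsOfFinAddOrder P)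
    (κ : ZpExtension K p) (hκ : κ.IsAnticyclotomic) (γ : Field.absoluteGaloisGroup K)
    [Fact (κ.IsTopGenerator γ)] (v : HeightOneSpectrum (𝓞 K)) (hv : ((p : ℕ) : 𝓞 K) ∈ v.asIdeal) :
    ControlOnTreeAt p κ v γ
      (embAt K p v hv (degreeOne_of_splitsIn hK.1.1 (hK.splitsIn_of_mult hmult (Ne.symm hqp)) hv).1
        (degreeOne_of_splitsIn hK.1.1 (hK.splitsIn_of_mult hmult (Ne.symm hqp)) hv).2) P := by
  have hsp : SplitsIn K p := hK.splitsIn_of_mult hmult (Ne.symm hqp)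
  exact controlOnTreeAt_of_mult_of_rankOne_odd W p hGZK hnf hPT hPT2 hp2 hmult hr hK.1 hsp hK.2.2.2.2 P hP
    κ hκ γ v hv _ _

/-- **`X^∅_ac(E/K_∞)_v` is `Λ`-torsion at an erratum datum, for ANY slot `v ∋ p`, from the four cited facts** —
drop-in replacement for `P2.RoadFF.isTorsion_XAc_empty_of_thm331_of_isErratumField` (first conjunct of the control
identity `XAc.HasCharValuationAt`). Same binders (`ErratumHypotheses W p`, `ord_{s=1} L(E,s) = 1`, the (ram)
witness `q`, an erratum field `K` for `q`, a non-torsion `P`, `κ`, `γ`, `v ∋ p`) with `h331 ↦ hPT, hPT2`; of these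
only `5 ≤ p`, `Mult W p`, `r_an = 1`, `q ≠ p` and the erratum field are used. CONDITIONAL on the four cited facts.
[cite: JetchevSkinnerWan2017, Thm. 3.3.1 with §3.5 (3.5.c) (arXiv:1512.06894 pp. 11, 15)]
[cite: Castella2018Erratum, proof of Thm. 1.1 (p. 4)] -/
theorem P2.RoadFF.isTorsion_XAc_empty_of_facts_of_isErratumField
    (hGZK : rank_eq_analyticRank_of_analyticRank_le_one) (hnf : exists_isNewformOf)
    (hPT : ∀ (K : Type) [Field K] [NumberField K], poitouTate_selmerStructure_duality K)
    (hPT2 : ∀ (K : Type) [Field K] [NumberField K], poitouTate_sha_tateDual K)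
    (hE : ErratumHypotheses W p) (hr : W.analyticRank = 1) {q : ℕ} [Fact q.Prime] (hqp : q ≠ p)
    (_hmq : Mult W q) (_hvq : ¬ p ∣ padicValInt q W.minimalDiscriminantInt) (hK : IsErratumField W K q)
    (P : (W.baseChange K).toAffine.Point) (hP : ¬ IsOfFinAddOrder P)
    (κ : ZpExtension K p) (hκ : κ.IsAnticyclotomic) (γ : Field.absoluteGaloisGroup K)
    [Fact (κ.IsTopGenerator γ)] (v : HeightOneSpectrum (𝓞 K)) (hv : ((p : ℕ) : 𝓞 K) ∈ v.asIdeal) :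
    Module.IsTorsion (IwasawaAlgebra p) (XAc (W.baseChange K) p κ v ∅ γ) := by
  have hp2 : p ≠ 2 := by
    have h5 : 5 ≤ p := hE.1
    omega
  obtain ⟨n, hn, -⟩ := P2.RoadFF.controlOnTreeAt_of_facts_of_isErratumField W p hGZK hnf hPT hPT2 hp2 hE.2.1 hr hqp
    hK P hP κ hκ γ v hv
  exact hn.1

end Torsion

end Summit.BirchSwinnertonDyer.Rank1Residual.X11b

namespace Summit.BirchSwinnertonDyer.BirchSwinnertonDyer.Theorems

/-! ### §4 One-sided tightness on the (ram) atom with the control hypothesis discharged by the facts -/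

section OneSided

variable (W : WeierstrassCurve ℚ) [W.IsElliptic] [W.IsGloballyMinimal] (p : ℕ) [Fact p.Prime]

/-- **On the (ram) atom, the lower half ALONE gives THE open input — control from the four cited facts.** imc-p1's
one-sided tightness `openInputOnTreeAt_of_missingLowerBoundAt_of_ram` (`Typed.MissingLowerBoundAt W p` +
`P2ControlOnTreeAt W p` + `Ram W p` ⟹ `P2OpenInputOnTreeAt W p`) with its control hypothesis `hC` DISCHARGED by
`p2ControlOnTreeAt_of_facts`. Drop-in replacement for `openInputOnTreeAt_of_missingLowerBoundAt_of_ram_of_thm331Mult`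
with `h ↦ hnf, hPT, hPT2`. CONDITIONAL on the named facts; a TIGHTNESS statement; nothing booked.
[cite: JetchevSkinnerWan2017, Thm. 3.3.1 with §3.5 (3.5.c) (arXiv:1512.06894 pp. 11, 15)]
[cite: Castella2018, Thm. 3.2 (arXiv:1704.06608 p. 9)] [cite: Skinner2016PacificMC, Thm. C (§1)]
[cite: Kolyvagin1990, Thm. A] -/
theorem openInputOnTreeAt_of_missingLowerBoundAt_of_ram_of_facts
    (hGZ : ∀ (N : ℕ) [NeZero N] (W : WeierstrassCurve ℚ) (K : Type) [Field K] [NumberField K],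
      gross_zagier N W K)
    (hKo : ∀ (N : ℕ) [NeZero N] (W : WeierstrassCurve ℚ) (K : Type) [Field K] [NumberField K],
      kolyvagin N W K)
    (hSk : Skinner2016.thmC_padicValRat_bsd_rank_zero)
    (hGZK : rank_eq_analyticRank_of_analyticRank_le_one) (hnf : exists_isNewformOf)
    (hPT : ∀ (K : Type) [Field K] [NumberField K], poitouTate_selmerStructure_duality K)
    (hPT2 : ∀ (K : Type) [Field K] [NumberField K], poitouTate_sha_tateDual K)
    (hram : Ram W p) (hlow : Typed.MissingLowerBoundAt W p) : P2OpenInputOnTreeAt W p :=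
  openInputOnTreeAt_of_missingLowerBoundAt_of_ram W p hGZ hKo hSk hGZK
    (hasEntireLFunction_rat_of_exists_isNewformOf hnf)
    (p2ControlOnTreeAt_of_facts W p hGZK hnf hPT hPT2) hram hlow

end OneSided

end Summit.BirchSwinnertonDyer.BirchSwinnertonDyer.Theorems

end
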